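import Summits.BirchSwinnertonDyer.BirchSwinnertonDyer.Theorems.UniversalToricDescentTwinSplitIMCAtThreeMultValueRoute
import Summits.BirchSwinnertonDyer.Rank1Residual.X11b.BDPRouteHsiehFrame
import Summits.BirchSwinnertonDyer.Rank1Residual.X11b.LambdaSupplyPrime
import Literature.NumberTheory.EllipticCurves.Hsieh2014.AnticyclotomicPAdicLFunctionAnyLevel
import HarnessLib

/-!
# Route `UniversalToricDescent`, child `TwinSplitIMCAtThreeMult` (item stmt-BirchSwinnertonDyer-20694; bucket B =
# 675 of the 2 023 twin classes): the UNIT TIER in the ♭-receptacle `𝓞_{ℂ₃}⟦T⟧` from REFEREED PRINT ALONE —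
# Hsieh 2014 Thm. A (the ♭-frame at `3 ∥ N′`), Liu–Zhang–Zhang 2018 (its value), Jetchev–Skinner–Wan 2017 (control)

Seat `bsd-wall-utd-p2` g3 (D-0131 (3) MIDDLE tier; memo `HOME/bsd-wall/bsd-wall-utd-p2/SUPSET-AT3-v6.md`). Companion
of `…TwinSplitIMCAtThreeMultValueRoute` (p553371). There, at a UNIT pair the child's conjuncts (i) ∧ (ii) follow from
conjunct (i) alone — the existence of an `R₀`-valued frame at `3 ∥ N′`, which is NOT in print (Castella–Hsieh 2018
Def. 3.5 `p ∤ N`; Castella 2018 Thm. 3.1 `p ≥ 5`; x11b3's residual `BDPExistsAt₃` ∕ `HsiehDescentAt₃`). In the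
♭-receptacle `𝓞_{ℂ₃}⟦T⟧` (kmc g19's re-type kit (A): `UnrSeries 3 ↦ PowerSeries 𝓞_ℂ_[3]`, `IsBDPLFunction ↦
R1.IsBDPLFunctionInt 3`, `toUnr 3 ↦ R1.toCpInt 3`; text `TwinSplitIMCAtThreeFlat` of
`pub/bsd-potss/bsd-potss-kmc/g19/retype-A/GlueCheckA.lean`) the frame IS print: Hsieh, Doc. Math. 19 (2014) Thm. A
at any level (`Hsieh2014.thmA_exists_isHsiehLFunction_unrPeriod_anyLevel`) with the tree's `λ`-supply
(`X11b.lambdaSupplyAt`) and Hsieh→Castella glue (`X11b.exists_isBDPLFunctionInt_of_isHsiehLFunction`, `p ∣ N`). Hence: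

* §1 `intSeries_norm_constantCoeff_eq_of_frameInt_of_mult_of_lzz` — EVERY ♭-frame `Q` of `Dt′.f` at a
  multiplicative-at-`3` twin has `‖Q(0)‖ = ‖(1 − a₃3⁻¹)·log_ω P‖²` (LZZ18 only; the ♭-core of p553371 §2).
* §2 `exists_frameInt_of_mult_of_hsiehAnyLevel` — a ♭-frame EXISTS at every `(ι′, 𝔭)` (Hsieh14 Thm. A only).
* §3 `twinSplitFlat_instance_of_mult_of_unitPair_of_print` — at a UNIT pair (`3 ∤ #Ш(E′/K)[3^∞]`, `3 ∤ ∏_{w split}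
  c_w`, `3 ∤ [E′(K):ℤP]`, `‖log_ω P‖ = 3⁻¹`; rank one, `Ш[3^∞]` finite, `P` over the Heegner point non-torsion,
  `3 ∤ c(Dt′)`, `ρ̄₃` onto, `d_K` odd): conjuncts (i♭) ∧ (ii♭) of `TwinSplitIMCAtThreeFlat` hold at the instance —
  `Ch_Λ(X_ac)·𝓞_{ℂ₃}⟦T⟧ = ⊤ = (Q′)` for every ♭-frame `Q′` — CONDITIONAL ONLY on three REFEREED named facts
  (`hA` Hsieh14, `hF` LZZ18, `h331` JSW17). No research statement, no PRE claim, no port.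

PARTITION currency (bucket B, 675): in ♭-currency the B_unit rank-one instances (census QU1b: first pass 10/10 unit;
square-free cap 461; full run kit j285092) are CLOSED FROM REFEREED PRINT by §3; in the route's `R₀`-currency
they wait on the `R₀`-descent only (p553371 §5). Degenerate tier (both sides `⊤`), but a class-wide statement at
`p = 3 ∥ N′` that no source prints (Castella 2018: `p ≥ 5`). Beyond-print BSD theorem: NO (BSD₃ of the twin pair is
among the hypotheses in index form). `--supports stmt-BirchSwinnertonDyer-20694`.

References: [Hsieh2014] Thm. A (Doc. Math. 19 p. 712); [LiuZhangZhang2018] Thm. 1.5.1, Rem. 1.1.2, Thm. 1.5.3;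
[JetchevSkinnerWan2017] Thm. 3.3.1, Prop. 3.2.1, (3.5.c); [Castella2018] Thm. 2.3 (`p ∣ N`), Thms. 3.1–3.2 (shapes).
-/

noncomputable section

open scoped Classical Topology

set_option linter.dupNamespace false
set_option autoImplicit false

namespace Summit.BirchSwinnertonDyer.BirchSwinnertonDyer.Theorems.UniversalToricDescentTwinSplit

open Filter PowerSeries WeierstrassCurve NumberField IsDedekindDomain Field
  Literature.NumberTheory.EllipticCurves
  Literature.NumberTheory.EllipticCurves.ModularForms
  Literature.NumberTheory.EllipticCurves.Rank1Residual
  Literature.NumberTheory.EllipticCurves.JetchevSkinnerWan2017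
  Literature.NumberTheory.GaloisRepresentations
  Literature.NumberTheory.GaloisCohomology
  Summit.BirchSwinnertonDyer.Rank1Residual
  Summit.BirchSwinnertonDyer.Rank1Residual.X11b
  Summit.BirchSwinnertonDyer.Rank1Residual.X11b.Halves
  Summit.BirchSwinnertonDyer.Rank1Residual.X11b.CongruenceLimit
  Summit.BirchSwinnertonDyer.BirchSwinnertonDyer.Theorems.SchneiderFree

section Three

variable (W' : WeierstrassCurve ℚ) [W'.IsElliptic] [W'.IsGloballyMinimal] (N' : ℕ) [NeZero N']
  (K : Type) [Field K] [NumberField K] (Dt' : ModularParametrizationData W' N')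
  (κ : ZpExtension K 3) (γ : absoluteGaloisGroup K)
  (𝔭 𝔭' : HeightOneSpectrum (𝓞 K)) (ι' : PadicAlgCl 3 ≃+* ℂ)

/-! ## §1 The value of EVERY ♭-frame at a multiplicative twin (norm form), from LZZ18 -/

/-- **The value at `𝟙` of EVERY ♭-frame at a multiplicative twin (norm form), from the REFEREED LZZ fact** — the
`𝓞_{ℂ₃}⟦T⟧`-core of p553371's `norm_constantCoeff_eq_of_frame_of_mult_of_lzz`. `W′` globally minimal,
MULTIPLICATIVE at `3`, conductor `N′`; `Dt′` with `3 ∤ c(Dt′)`; `K` imaginary quadratic, Heegner for `N′`, `d_K` odd;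
`P ∈ E′(K)` over the Heegner point of `(Dt′, H)` along `ι_K`, of INFINITE order; `κ` anticyclotomic with generator
`γ`; `𝔭 ∋ 3` of degree one; `ι′` inducing `𝔭`. Then every ♭-frame `(Ω_K ≠ 0, Ω_p ≠ 0, Q ∈ 𝓞_{ℂ₃}⟦T⟧)` with
`R1.IsBDPLFunctionInt 3 ι′ 𝔭 κ γ Dt′.f Ω_K Ω_p Q` has `‖Q(0)‖ = ‖(1 − a₃3⁻¹)·log_ω P‖²` (log at `embAt K 3 𝔭`).
No rank ∕ image ∕ twist ∕ period-unit hypothesis. CONDITIONAL on the named fact `hF`.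
[cite: LiuZhangZhang2018, Thm. 1.5.1 and Remark 1.1.2 and Thm. 1.5.3 (Duke Math. J. 167 (2018) pp. 745–749)]
[cite: Castella2018, Thm. 3.1–3.2 (arXiv:1704.06608 pp. 8–9) (display and value shapes)] -/
theorem intSeries_norm_constantCoeff_eq_of_frameInt_of_mult_of_lzz
    (hF : LiuZhangZhang2018.thm151_thm153_modularCurve_heegnerVector)
    (hmult : Mult W' 3) (hN' : W'.conductorNorm ℤ = N') (hcM : ¬ (3 : ℤ) ∣ Dt'.c)
    (hK : IsImaginaryQuadratic K) (hH : SatisfiesHeegnerHypothesis N' K) (hodd : Odd (NumberField.discr K))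
    (hκ : κ.IsAnticyclotomic) [hγ : Fact (κ.IsTopGenerator γ)]
    (h𝔭 : ((3 : ℕ) : 𝓞 K) ∈ 𝔭.asIdeal) (he : 𝔭.asIdeal.ramificationIdx (𝓞 ℚ) = 1)
    (hf : 𝔭.asIdeal.inertiaDeg (𝓞 ℚ) = 1) (hι' : BranchInducesPrime 3 ι' 𝔭)
    (H : HeegnerDatum N' (NumberField.discr K)) (ιK : K →+* ℂ) (P : (W'.baseChange K).toAffine.Point)
    (hPH : WeierstrassCurve.Affine.Point.map ιK.toRatAlgHom P = heegnerPointComplex Dt' H) (hP0 : ¬ IsOfFinAddOrder P)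
    {ΩK : ℂ} {Ωp : ℂ_[3]} {Q : PowerSeries 𝓞_ℂ_[3]} (hΩK : ΩK ≠ 0) (hΩp : Ωp ≠ 0)
    (hQ : R1.IsBDPLFunctionInt 3 ι' 𝔭 κ γ Dt'.f ΩK Ωp Q) :
    ‖((PowerSeries.constantCoeff Q : 𝓞_ℂ_[3]) : ℂ_[3])‖ =
      ‖algebraMap ℚ_[3] ℂ_[3] (((1 : ℚ_[3]) - ((W'.LFunction 3 : ℤ) : ℚ_[3]) * (3 : ℚ_[3])⁻¹) *
        logOmega W' 3 (embAt K 3 𝔭 h𝔭 he hf) P)‖ ^ 2 := by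
  have hp : (3 : ℕ).Prime := Fact.out
  -- the dictionary: `3 ∣ N′`, `9 ∤ N′`, `3` split in `K`, `3 ∤ d_K`, `d_K < -4`
  have hpN : 3 ∣ N' := hN' ▸ X11b.dvd_conductorNorm_of_mult (W := W') hmult
  have hp2N : ¬ 3 ^ 2 ∣ N' := hN' ▸ X2.not_sq_dvd_conductorNorm_of_mult W' 3 hmult
  have hsplit : ((Ideal.span {((3 : ℕ) : ℤ)}).primesOver (𝓞 K)).ncard = 2 := hH 3 hp hpN
  have hdisc : ¬ ((3 : ℕ) : ℤ) ∣ NumberField.discr K :=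
    Literature.SatisfiesHeegnerHypothesis.not_dvd_discr hK.1 hH hp hpN
  have hd4 : NumberField.discr K < -4 := discr_lt_neg_four_of_odd_of_not_three_dvd hK hodd hdisc
  have hemb : ∀ k : 𝓞 K, k ∈ 𝔭.asIdeal ↔ ‖embAt K 3 𝔭 h𝔭 he hf (k : K)‖ < 1 :=
    mem_asIdeal_iff_norm_embAt_lt_one 𝔭 h𝔭 he hf
  -- the bsd-eis rescale at this datum (LZZ road)
  obtain ⟨ΩK₀, Ωp₀, u, hΩK₀, hΩp₀, hu, hcont⟩ :=
    X2.exists_continuousDisplay_of_lzzRoadInputIoo (X2.lzzRoadInputIoo_of_thm151_thm153 hF) ι' W' K 𝔭 κ γ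
      Dt' H ιK (embAt K 3 𝔭 h𝔭 he hf) P Dt'.f (by decide) hmult hN' hpN hp2N hK hd4 hsplit h𝔭 hι' hH hκ
      hγ.out Dt'.isNewformOf hcM hPH hemb
  -- the NORMS of the displays tend to `‖V‖²`
  have hVN : ∀ (φ : ℕ → HeckeCharacter K) (n : ℕ → ℕ) (r : ℕ → FramedGaloisRep K (PadicAlgCl 3) 1),
      (∀ k, 0 < n k) → (∀ k (v : HeightOneSpectrum (𝓞 K)), (φ k).IsUnramifiedAt v) →
      (∀ k, (φ k).HasInfinityType (fun _ ↦ (n k : ℤ)) (fun _ ↦ -(n k : ℤ))) →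
      (∀ k, IsPAdicAvatarOf ι' (φ k) (r k)) → (∀ k, FactorsThroughZp κ (r k)) →
      Tendsto (fun k ↦ avatarValueAt (r k) γ) atTop (𝓝 1) →
      Tendsto (fun k ↦ ‖((ι'.symm (bdpInterpolationValue 3 Dt'.f 𝔭 (φ k) (n k) ΩK₀) :
        PadicAlgCl 3) : ℂ_[3]) * Ωp₀ ^ (4 * n k)‖) atTop
        (𝓝 (‖algebraMap ℚ_[3] ℂ_[3] (((1 : ℚ_[3]) - ((W'.LFunction 3 : ℤ) : ℚ_[3]) *
            (3 : ℚ_[3])⁻¹) * logOmega W' 3 (embAt K 3 𝔭 h𝔭 he hf) P)‖ ^ 2)) := by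
    intro φ n r hn hunr hinf hav hfac hlim
    have h := (hcont φ n r hn hunr hinf hav hfac hlim).norm
    rwa [norm_mul, hu, one_mul, norm_pow, ← R1.logOmega_eq_padicLogOmega] at h
  -- the target is non-zero: `a₃ = ±1`, `log_ω P ≠ 0`
  have ha : W'.LFunction 3 = 1 ∨ W'.LFunction 3 = -1 :=
    X11b.Three.lFunction_eq_one_or_eq_neg_one_of_isNewformOf W' Dt'.isNewformOf hmult
  have hx : ((1 : ℚ_[3]) - ((W'.LFunction 3 : ℤ) : ℚ_[3]) * (3 : ℚ_[3])⁻¹) *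
      logOmega W' 3 (embAt K 3 𝔭 h𝔭 he hf) P ≠ 0 := by
    refine mul_ne_zero ?_ (R1.logOmega_ne_zero W' 3 (embAt K 3 𝔭 h𝔭 he hf) hP0)
    rcases ha with ha | ha <;> rw [ha] <;> norm_num
  have hN0 : ‖algebraMap ℚ_[3] ℂ_[3] (((1 : ℚ_[3]) - ((W'.LFunction 3 : ℤ) : ℚ_[3]) * (3 : ℚ_[3])⁻¹) *
      logOmega W' 3 (embAt K 3 𝔭 h𝔭 he hf) P)‖ ^ 2 ≠ 0 :=
    pow_ne_zero _ (norm_ne_zero_iff.mpr ((map_ne_zero_iff _ (algebraMap ℚ_[3] ℂ_[3]).injective).mpr hx))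
  -- one-sided norm rigidity onto the given ♭-frame
  exact intSeries_norm_constantCoeff_eq_of_isBDPLFunctionInt_of_continuousNorms (p := 3) (by decide)
    hK hκ hγ.out hΩK₀ hΩK hΩp₀ hΩp hVN hN0 hQ

/-! ## §2 A ♭-frame EXISTS at every `(ι′, 𝔭)` of a multiplicative twin, from Hsieh 2014 Thm. A -/

omit [W'.IsGloballyMinimal] in
/-- **Conjunct (i♭) at a multiplicative twin, from Hsieh 2014 Thm. A at any level.** `W′` globally minimal,
MULTIPLICATIVE at `3`, conductor `N′`; `K` imaginary quadratic, Heegner for `N′`; `κ` anticyclotomic with generator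
`γ`; `𝔭 ∋ 3`; `ι′` inducing `𝔭`. Then a ♭-frame `(Ω_K ≠ 0, Ω_p ≠ 0, Q ∈ 𝓞_{ℂ₃}⟦T⟧)` with
`R1.IsBDPLFunctionInt 3 ι′ 𝔭 κ γ Dt′.f Ω_K Ω_p Q` EXISTS: the `λ`-supply `X11b.lambdaSupplyAt`, Hsieh's Thm. A
(`hA`), and the Hsieh→Castella glue `X11b.exists_isBDPLFunctionInt_of_isHsiehLFunction` (`3 ∣ N′`). The `R₀`-descent
`Q ↦ L ∈ R₀⟦T⟧` (conjunct (i) of the child as typed) is NOT claimed. CONDITIONAL on the named fact `hA`.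
[cite: Hsieh2014, Thm. A p. 712 (Doc. Math. 19) = Thm. 1 (arXiv:1112.1580 pp. 3–4)]
[cite: Castella2018, Thm. 3.1 (arXiv:1704.06608 p. 9) (the frame predicate)] -/
theorem exists_frameInt_of_mult_of_hsiehAnyLevel
    (hA : Hsieh2014.thmA_exists_isHsiehLFunction_unrPeriod_anyLevel)
    (hmult : Mult W' 3) (hN' : W'.conductorNorm ℤ = N')
    (hK : IsImaginaryQuadratic K) (hH : SatisfiesHeegnerHypothesis N' K)
    (hκ : κ.IsAnticyclotomic) [hγ : Fact (κ.IsTopGenerator γ)]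
    (h𝔭 : ((3 : ℕ) : 𝓞 K) ∈ 𝔭.asIdeal) (hι' : BranchInducesPrime 3 ι' 𝔭) :
    ∃ (ΩK : ℂ) (Ωp : ℂ_[3]) (Q : PowerSeries 𝓞_ℂ_[3]), ΩK ≠ 0 ∧ Ωp ≠ 0 ∧
      R1.IsBDPLFunctionInt 3 ι' 𝔭 κ γ Dt'.f ΩK Ωp Q := by
  have hp : (3 : ℕ).Prime := Fact.out
  have hpN : 3 ∣ N' := hN' ▸ X11b.dvd_conductorNorm_of_mult (W := W') hmult
  have hsplit : ((Ideal.span {((3 : ℕ) : ℤ)}).primesOver (𝓞 K)).ncard = 2 := hH 3 hp hpN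
  obtain ⟨lam, rlam, hunit, hinfl, hAQ, hunrl, havl, hfacl⟩ := lambdaSupplyAt (p := 3) (by decide) ι' K κ hK hκ
  obtain ⟨A, ΩK₀, C, Ωp, Q₀, hA0, hΩK₀, hC, hQ₀⟩ :=
    hA ι' K 𝔭 κ γ Dt'.f lam rlam (by decide) Dt'.isNewformOf.1 hK hsplit h𝔭 hι' hH hunit hinfl hAQ hunrl havl
      hfacl hκ hγ.out
  obtain ⟨ΩK, c, hΩK, -, hQ⟩ :=
    exists_isBDPLFunctionInt_of_isHsiehLFunction ι' 𝔭 κ γ Dt'.f hpN hA0 hΩK₀ hC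
      ((Ωp : unrIntegers 3) : ℂ_[3]) hQ₀
  have hΩp : ((Ωp : unrIntegers 3) : ℂ_[3]) ≠ 0 := fun h0 ↦ by
    have h1 := norm_coe_units_unrIntegers 3 Ωp
    rw [h0, norm_zero] at h1
    exact zero_ne_one h1
  exact ⟨ΩK, _, _, hΩK, hΩp, hQ⟩

/-! ## §3 The UNIT TIER in ♭-currency from refereed print alone -/

/-- **Conjuncts (i♭) ∧ (ii♭) of the ♭-typed child B at a UNIT pair, from REFEREED PRINT ALONE.** `W′` globally
minimal, MULTIPLICATIVE at `3`, `ρ̄_{W′,3}` onto over `ℚ`, conductor `N′`; `Dt′` with `3 ∤ c(Dt′)`; `K` imaginary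
quadratic, Heegner for `N′`, `d_K` odd; `κ` anticyclotomic with generator `γ`; `𝔭 ∋ 3` of degree one, `𝔭′ ∋ 3`
(the STRICT prime); `ι′` inducing `𝔭`; `P ∈ E′(K)` over the Heegner point of `(Dt′, H)`, non-torsion;
`rank_ℤ E′(K) = 1`, `Ш(E′/K)[3^∞]` finite; and the UNIT clauses `3 ∤ #Ш(E′/K)[3^∞]`, `3 ∤ ∏_{w split} c_w(E′/K)`,
`3 ∤ [E′(K):ℤP]`, `‖log_ω P‖ = 3⁻¹`. Then (i♭) a ♭-frame of `Dt′.f` at `(ι′, 𝔭)` exists (§2) and (ii♭) for EVERY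
♭-frame `Q′`: `Ch_Λ(X_ac(W′_K) strict at 𝔭′)·𝓞_{ℂ₃}⟦T⟧ = (Q′)` — indeed both sides are `⊤`: JSW's generator has
`ord₃ f(0) = 0 + 2·((1 − 1) − 0) + 0 = 0` (control at `𝔭′`, `ord₃ log` transported from `𝔭` by log symmetry), and
`‖Q′(0)‖ = (3·3⁻¹)² = 1` (§1). This is the text `TwinSplitIMCAtThreeFlat` of kmc g19's re-type kit (A) at the
instance. CONDITIONAL ONLY on `hA` (Hsieh 2014 Thm. A), `hF` (LZZ 2018), `h331` (JSW 2017) — all refereed.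
[cite: Hsieh2014, Thm. A p. 712 (Doc. Math. 19)]
[cite: LiuZhangZhang2018, Thm. 1.5.1 and Thm. 1.5.3 (Duke Math. J. 167 pp. 748–749)]
[cite: JetchevSkinnerWan2017, Thm. 3.3.1 with Prop. 3.2.1 and §3.5 (3.5.c) (arXiv:1512.06894 pp. 10–15)] -/
theorem twinSplitFlat_instance_of_mult_of_unitPair_of_print
    (hA : Hsieh2014.thmA_exists_isHsiehLFunction_unrPeriod_anyLevel)
    (hF : LiuZhangZhang2018.thm151_thm153_modularCurve_heegnerVector) (h331 : thm331_anticyclotomicControl_mult)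
    (hmult : Mult W' 3) (hsurj : W'.HasSurjectiveModNGaloisRep 3) (hN' : W'.conductorNorm ℤ = N') (hcM : ¬ (3 : ℤ) ∣ Dt'.c)
    (hK : IsImaginaryQuadratic K) (hH : SatisfiesHeegnerHypothesis N' K) (hodd : Odd (NumberField.discr K))
    (hκ : κ.IsAnticyclotomic) [hγ : Fact (κ.IsTopGenerator γ)]
    (h𝔭 : ((3 : ℕ) : 𝓞 K) ∈ 𝔭.asIdeal) (he : 𝔭.asIdeal.ramificationIdx (𝓞 ℚ) = 1)
    (hf : 𝔭.asIdeal.inertiaDeg (𝓞 ℚ) = 1) (h𝔭' : ((3 : ℕ) : 𝓞 K) ∈ 𝔭'.asIdeal) (hι' : BranchInducesPrime 3 ι' 𝔭)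
    (H : HeegnerDatum N' (NumberField.discr K)) (ιK : K →+* ℂ) (P : (W'.baseChange K).toAffine.Point)
    (hPH : WeierstrassCurve.Affine.Point.map ιK.toRatAlgHom P = heegnerPointComplex Dt' H) (hP0 : ¬ IsOfFinAddOrder P)
    (hrk : (W'.baseChange K).mordellWeilRank = 1) (hfin : Finite (AddCommGroup.primaryComponent (W'.baseChange K).sha 3))
    (hSha : ¬ 3 ∣ Nat.card (AddCommGroup.primaryComponent (W'.baseChange K).sha 3))
    (hTam : ¬ 3 ∣ splitTamagawaProduct W' K) (hInd : ¬ 3 ∣ (AddSubgroup.zmultiples P).index)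
    (hlog : ‖logOmega W' 3 (embAt K 3 𝔭 h𝔭 he hf) P‖ = (3 : ℝ)⁻¹) :
    (∃ (ΩK : ℂ) (Ωp : ℂ_[3]) (Q' : PowerSeries 𝓞_ℂ_[3]), ΩK ≠ 0 ∧ Ωp ≠ 0 ∧
        R1.IsBDPLFunctionInt 3 ι' 𝔭 κ γ Dt'.f ΩK Ωp Q') ∧
      (∀ (ΩK : ℂ) (Ωp : ℂ_[3]) (Q' : PowerSeries 𝓞_ℂ_[3]), ΩK ≠ 0 → Ωp ≠ 0 →
        R1.IsBDPLFunctionInt 3 ι' 𝔭 κ γ Dt'.f ΩK Ωp Q' →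
        (AcSelmer.XAc.charIdeal (W'.baseChange K) 3 κ 𝔭' ∅ γ).map (PowerSeries.map (R1.toCpInt 3)) =
          Ideal.span {Q'}) := by
  have hp : (3 : ℕ).Prime := Fact.out
  have h2 : Module.finrank ℚ K = 2 := hK.1
  have hpN : 3 ∣ N' := hN' ▸ X11b.dvd_conductorNorm_of_mult (W := W') hmult
  have hspl : ((Ideal.span {((3 : ℕ) : ℤ)}).primesOver (𝓞 K)).ncard = 2 := hH 3 hp hpN
  have hirrK : (W'.baseChange K).HasIrreducibleModPGaloisRep 3 := irrK_of_surj W' 3 hsurj K h2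
  obtain ⟨he', hf'⟩ := degreeOne_of_splitsIn (p := 3) h2 hspl h𝔭'
  have hH3 : SatisfiesHeegnerHypothesis 3 K := satisfiesHeegnerHypothesis_three_of_ncard hspl
  set e := embAt K 3 𝔭 h𝔭 he hf with hedef
  set e' := embAt K 3 𝔭' h𝔭' he' hf' with he'def
  -- CONTROL at the strict prime `𝔭′` (JSW 3.3.1, multiplicative): `Ch = (f₀)`, `ord₃ f₀(0) = …`
  obtain ⟨-, f₀, hf₀, hf₀0, hval⟩ := h331 W' 3 le_rfl hmult K hK hH3 hirrK e' 𝔭'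
    (mem_asIdeal_iff_norm_embAt_lt_one 𝔭' h𝔭' he' hf') κ hκ γ hrk hfin P hP0
  -- `ord₃ log_ω P = 1` at `e`, hence at `e'`
  have hx0 : logOmega W' 3 e P ≠ 0 := R1.logOmega_ne_zero W' 3 e hP0
  have hxval1 : (logOmega W' 3 e P).valuation = 1 := by
    have hn := Padic.norm_eq_zpow_neg_valuation hx0
    rw [hlog] at hn
    have h3 : (1 : ℝ) < 3 := by norm_num
    have := zpow_right_injective₀ (by norm_num : (0 : ℝ) < 3) h3.ne'
      (show ((3 : ℕ) : ℝ) ^ (-(1 : ℤ)) = ((3 : ℕ) : ℝ) ^ (-(logOmega W' 3 e P).valuation) by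
        rw [← hn]; norm_num)
    linarith
  have hlogOrd : Literature.NumberTheory.EllipticCurves.padicLogOrd W' 3 e' P = 1 := by
    have htrans : Literature.NumberTheory.EllipticCurves.padicLogOrd W' 3 e' P =
        Literature.NumberTheory.EllipticCurves.padicLogOrd W' 3 e P := by
      rw [← padicLogOrd_eq_literature, ← padicLogOrd_eq_literature]
      exact LogSymmetry.padicLogOrd_eq_of_finrank_eq_two W' 3 (by decide) h2 e e' hrk P hP0
    rw [htrans, ← Castella2018.valuation_padicLogOmega (by rw [← R1.logOmega_eq_padicLogOmega]; exact hx0),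
      ← R1.logOmega_eq_padicLogOmega, hxval1]
  -- hence `ord₃ f₀(0) = 0`, `f₀` is a unit, `Ch = ⊤`
  have hval0 : ((PowerSeries.constantCoeff f₀).valuation : ℤ) = 0 := by
    rw [hval, hlogOrd, padicValNat.eq_zero_of_not_dvd hSha, padicValNat.eq_zero_of_not_dvd hTam,
      padicValNat.eq_zero_of_not_dvd hInd]
    simp
  have hf₀u : IsUnit f₀ := by
    rw [PowerSeries.isUnit_iff_constantCoeff, PadicInt.isUnit_iff]
    have hn := PadicInt.norm_eq_zpow_neg_valuation hf₀0
    rw [hn]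
    have : ((PowerSeries.constantCoeff f₀).valuation : ℤ) = 0 := hval0
    simp [this]
  have htop : (AcSelmer.XAc.charIdeal (W'.baseChange K) 3 κ 𝔭' ∅ γ).map (PowerSeries.map (R1.toCpInt 3)) = ⊤ := by
    rw [xac_charIdeal_eq_literature, hf₀, Ideal.map_span, Set.image_singleton, Ideal.span_singleton_eq_top]
    exact hf₀u.map _
  -- every ♭-frame generates `⊤`: `‖Q′(0)‖ = (3·3⁻¹)² = 1`
  have ha : W'.LFunction 3 = 1 ∨ W'.LFunction 3 = -1 :=
    X11b.Three.lFunction_eq_one_or_eq_neg_one_of_isNewformOf W' Dt'.isNewformOf hmult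
  have hQtop : ∀ (ΩK : ℂ) (Ωp : ℂ_[3]) (Q' : PowerSeries 𝓞_ℂ_[3]), ΩK ≠ 0 → Ωp ≠ 0 →
      R1.IsBDPLFunctionInt 3 ι' 𝔭 κ γ Dt'.f ΩK Ωp Q' → Ideal.span {Q'} = ⊤ := by
    intro ΩK Ωp Q' hΩK hΩp hQ'
    have hn : ‖((PowerSeries.constantCoeff Q' : 𝓞_ℂ_[3]) : ℂ_[3])‖ = 1 := by
      rw [intSeries_norm_constantCoeff_eq_of_frameInt_of_mult_of_lzz W' N' K Dt' κ γ 𝔭 ι' hF hmult hN' hcM hK hH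
        hodd hκ h𝔭 he hf hι' H ιK P hPH hP0 hΩK hΩp hQ', norm_algebraMap', norm_mul, hlog,
        show ‖(1 : ℚ_[3]) - ((W'.LFunction 3 : ℤ) : ℚ_[3]) * (3 : ℚ_[3])⁻¹‖ = (3 : ℕ) from
          Halves.norm_one_sub_div_eq (p := 3) ha]
      norm_num
    rw [Ideal.span_singleton_eq_top, PowerSeries.isUnit_iff_constantCoeff]
    exact isUnit_padicComplexInt_of_norm_eq_one hn
  refine ⟨exists_frameInt_of_mult_of_hsiehAnyLevel W' N' K Dt' κ γ 𝔭 ι' hA hmult hN' hK hH hκ h𝔭 hι',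
    fun ΩK Ωp Q' hΩK hΩp hQ' ↦ ?_⟩
  rw [htop, hQtop ΩK Ωp Q' hΩK hΩp hQ']

end Three

end Summit.BirchSwinnertonDyer.BirchSwinnertonDyer.Theorems.UniversalToricDescentTwinSplit

end
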